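import Literature.AlgebraicGeometry.HodgeTheory.SaitoGrFDeRhamCurveNetClassical
import Literature.AlgebraicGeometry.HodgeTheory.HodgeFiltrationModelsReductionProofs
import Literature.Barriers.HodgeConjecture.GeneralizedHodgeTrivialReasonsSubHodgeProofs
import Literature.AlgebraicGeometry.HodgeTheory.ComplexGysinHodgeType
import Literature.AlgebraicGeometry.Motives.ComplexPointsOrientation
import Literature.AlgebraicGeometry.HodgeTheory.ComplexConjugationDischarge
import HarnessLib

/-!
# `curveNetSaitoData_nonempty` from named facts of the tree (and the polarizability of
# `Hᵏ(X(ℂ); ℚ)`)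

Family `hodge`, layer `Literature/AlgebraicGeometry/HodgeTheory`. Fourth file of the story
`SaitoGrFDeRhamCurveNet` (named fact `curveNetSaitoData_nonempty`: Saito's graded de Rham package
of `IC(R¹π_*ℚ)` of a curve net `N` on `ℙᵐ_ℂ`, `m ≥ 2`, anchored to `H^{m+1}(X̃(ℂ); ℂ)`),
`SaitoGrFDeRhamCurveNetProofs` (PROVED: the fact is equivalent to the existence of its Saito-free
anchor `CurveNetHodgeAnchor N`) and `SaitoGrFDeRhamCurveNetClassical` (PROVED: the classical anchor
`I = H^{m+1}(X̃(ℂ); ℚ)`, `I_T = ker (H^{m+1}(X̃) → H^{m+1}(X̃ ∖ π⁻¹T̄))`, hence the fact, from four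
classical inputs stated on the tree's carriers — (H1) a Hodge symmetric Hodge model, (H2) the
polarizability of `HodgeModel.hodgeStructure`, (H3) `hodgePQ_independent_of_hodgeModel`, (H4)
Deligne's theorem "`ker (Hᵏ(X) → Hᵏ(X ∖ Z))` is a sub-Hodge structure" in the per-kernel form of
the barrier catalogue — `curveNetSaitoData_nonempty_of_exists_isReal_hodgeModel`).

Since then two of these inputs have become available in the tree in sharper currency, and this
file threads them (theorems only; no definition, no named fact — D-0026):

* (H3) is now a THEOREM, `hodgePQ_independent_of_hodgeModel_holds`
  (`HodgeFiltrationModelsReductionProofs`: rigidity of natural de Rham comparisons, via the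
  scalar theorem for natural endomorphisms of `Hᵏ(−; ℂ)` on compact manifolds); hence
  `curveNetSaitoData_nonempty_of_exists_isReal_hodgeModel'` drops it.
* (H4) is, along Grothendieck's line (Topology 8 (1969), p. 300: "`Filt'ᵖ` can be also described
  as the space generated by the images of the Gysin homomorphisms […] As the previous homomorphisms
  are compatible with the Hodge structures, the assertion follows"), the theorem
  `Literature.Barriers.HodgeConjecture.kerRestriction_isSubHodge_of_gysinHodgeType` of the barrier
  catalogue fed with the bidegree theorem `isOfHodgeType_complexGysin` (Voisin I §7.3.2 with
  Lemma 7.30), whose hypotheses are NAMED facts of the tree: Deligne's description of the kernel of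
  restriction by Gysin images of desingularizations
  (`Deligne1974_ker_restrictCompl_eq_iSup_range_complexGysin`, Hodge III Cor. 8.2.8), Hironaka's
  resolution (`Resolution.Hironaka1964_projective`), Hodge models (`nonempty_hodgeModel`, implied by
  `exists_isReal_hodgeModel`) and de Rham's theorem in multiplicative form
  (`Literature.NumberTheory.Transcendental.exists_deRhamIsoFamily`); the orientation family is any
  one (orientations of the closed manifolds `Y(ℂ)` exist, `Motives.ComplexPoints.isOrientableOver`).

Main statement: `curveNetSaitoData_nonempty_of_namedFacts` — **the named fact
`curveNetSaitoData_nonempty` follows from the named facts `exists_isReal_hodgeModel`,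
`Deligne1974_ker_restrictCompl_eq_iSup_range_complexGysin`, `Resolution.Hironaka1964_projective`,
`exists_deRhamIsoFamily` (all finite-dimensional complex model spaces) and ONE un-named classical
input, the polarizability of the Hodge structures `HodgeModel.hodgeStructure` on `Hᵏ(Y(ℂ); ℚ)` of
smooth projective `Y`** (Hodge–Riemann bilinear relations with the Lefschetz decomposition,
Voisin I Thm. 6.32, §7.1.2; the tree states it only as a hypothesis, in this exact shape, cf.
`GysinHodgeClassLiftProofs`, `HodgeConjectureQbarVoisinProofs`). Its discharge
`curveNetSaitoData_nonempty_holds` is this theorem fed with the four `_holds` and a proof of the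
polarizability; nothing in it involves intersection cohomology or mixed Hodge modules
(`SaitoGrFDeRhamCurveNetProofs`, "Consequences").

Addendum (de Rham's theorem having since become a theorem of the tree, `DeRhamTheoremProofs`,
whence `exists_isReal_complexDeRhamIsoFamily_holds` and
`exists_isReal_hodgeModel_of_hodgeDecomposition` of `ComplexConjugationDischarge`):
`curveNetSaitoData_nonempty_of_hodgeDecomposition` — the same reduction with
`exists_isReal_hodgeModel` replaced by (4b) the Hodge decomposition of compact Kähler manifolds
(`Motives.isInternal_hodgePQ`) alone. The named fact therefore rests on exactly
{`Motives.isInternal_hodgePQ`, `Deligne1974_ker_restrictCompl_eq_iSup_range_complexGysin`,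
`Resolution.Hironaka1964_projective`, `exists_deRhamIsoFamily` (multiplicative form), `hpol`}.

## References

* [Saito1990] M. Saito, Mixed Hodge modules, Publ. RIMS 26 (1990), Thm. 0.1–0.2, §2.g, §4.5.
* [DeligneHodgeII1971] P. Deligne, Théorie de Hodge II, Cor. 3.2.17. [DeligneHodgeIII1974]
  Théorie de Hodge III, Cor. 8.2.8.
* [GrothendieckTopology1969] A. Grothendieck, Hodge's general conjecture is false for trivial
  reasons, Topology 8 (1969), p. 300.
* [VoisinHodgeI2002] C. Voisin, Hodge Theory and Complex Algebraic Geometry I (2002), Cor. 6.12,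
  Thm. 6.32, §7.1.2, §7.3.2 (Lemma 7.30).
-/

noncomputable section

open scoped Manifold ContDiff
open CategoryTheory AlgebraicGeometry
open Literature.AlgebraicTopology.SingularHomology
open Literature.NumberTheory.Transcendental (exists_deRhamIsoFamily)
open Literature.Barriers.HodgeConjecture (kerRestriction_isSubHodge_of_gysinHodgeType)

namespace Literature.AlgebraicGeometry.HodgeTheory

section HodgeTheory

/-- **`curveNetSaitoData_nonempty` from `exists_isReal_hodgeModel`, Deligne's theorem `hK`
(per-kernel form of the barrier catalogue) and the polarizability `hpol`** — the reduction
`curveNetSaitoData_nonempty_of_exists_isReal_hodgeModel` of `SaitoGrFDeRhamCurveNetClassical` with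
its hypothesis (H3) discharged by the theorem `hodgePQ_independent_of_hodgeModel_holds`.
[cite: Saito1990, Thm. 0.1–0.2, §2.g and §4.5] [cite: VoisinHodgeI2002, Cor. 6.12, Thm. 6.32 and §7.3.2]
[cite: VoisinChowRings2014, Thm. 2.39] -/
theorem curveNetSaitoData_nonempty_of_exists_isReal_hodgeModel' (hR : exists_isReal_hodgeModel)
    (hK : ∀ ⦃n : ℕ⦄ ⦃Y : Motives.SchemeOver ℂ⦄, Motives.IsSmoothProjective n Y →
      ∀ (A : HodgeModel n Y) (k : ℕ) (Z : Set Y.left), IsClosed Z →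
        (Submodule.span ℂ {x : complexBetti Y k |
            IsRationalClass x ∧ complexBetti.restrictCompl Y Z k x = 0}).map (A.pullback k).hom =
          ⨆ (p : ℕ) (q : ℕ) (_ : p + q = k),
            (Submodule.span ℂ {x : complexBetti Y k |
                IsRationalClass x ∧ complexBetti.restrictCompl Y Z k x = 0}).map
                (A.pullback k).hom ⊓ A.hodgePQ k p q)
    (hpol : ∀ ⦃n : ℕ⦄ ⦃Y : Motives.SchemeOver ℂ⦄ (hY : Motives.IsSmoothProjective n Y)
      (A : HodgeModel n Y) (hA : A.IsHodgeSymmetric) (k : ℕ), (A.hodgeStructure hY hA k).IsPolarizable) :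
    curveNetSaitoData_nonempty :=
  curveNetSaitoData_nonempty_of_exists_isReal_hodgeModel hR hodgePQ_independent_of_hodgeModel_holds
    hK hpol

/-- **`curveNetSaitoData_nonempty` from named facts of the tree and the polarizability of
`Hᵏ(Y(ℂ); ℚ)`.** Hypotheses: the named facts `exists_isReal_hodgeModel` (`hR`: real Hodge models —
the Hodge decomposition of `Y^an` with de Rham's comparison in real form, Voisin I Cor. 6.12 and
Thm. 6.18), `Deligne1974_ker_restrictCompl_eq_iSup_range_complexGysin` (`hD`: Hodge III
Cor. 8.2.8), `Resolution.Hironaka1964_projective` (`hH`), `exists_deRhamIsoFamily` for every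
finite-dimensional complex model space (`hdR`: de Rham's theorem, multiplicative form), and the
un-named polarizability `hpol` of `HodgeModel.hodgeStructure` (Voisin I Thm. 6.32, §7.1.2).
Proof: (H3) is `hodgePQ_independent_of_hodgeModel_holds`; (H4) in the per-kernel form `hK` is
`kerRestriction_isSubHodge_of_gysinHodgeType` (Grothendieck's line: Deligne + Hironaka + Hodge
models) fed with the bidegree `(r, r)` of the Gysin morphisms, `isOfHodgeType_complexGysin`
(Voisin I §7.3.2, Lemma 7.30, from `hdR` and the Hodge models `hR.nonempty_hodgeModel`), for ANY
orientation family (one exists: `Motives.ComplexPoints.isOrientableOver`; Hatcher §3.3 p. 235); then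
`curveNetSaitoData_nonempty_of_exists_isReal_hodgeModel'`.
[cite: Saito1990, Thm. 0.1–0.2, §2.g and §4.5] [cite: DeligneHodgeIII1974, Cor. 8.2.8]
[cite: GrothendieckTopology1969, p. 300] [cite: VoisinHodgeI2002, Cor. 6.12, Thm. 6.32 and §7.3.2 (with Lemma 7.30)] -/
theorem curveNetSaitoData_nonempty_of_namedFacts (hR : exists_isReal_hodgeModel)
    (hD : Deligne1974_ker_restrictCompl_eq_iSup_range_complexGysin)
    (hH : Literature.AlgebraicGeometry.Resolution.Hironaka1964_projective.{0})
    (hdR : ∀ (E : Type) [NormedAddCommGroup E] [NormedSpace ℂ E] [FiniteDimensional ℂ E],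
      exists_deRhamIsoFamily 𝓘(ℝ, E))
    (hpol : ∀ ⦃n : ℕ⦄ ⦃Y : Motives.SchemeOver ℂ⦄ (hY : Motives.IsSmoothProjective n Y)
      (A : HodgeModel n Y) (hA : A.IsHodgeSymmetric) (k : ℕ), (A.hodgeStructure hY hA k).IsPolarizable) :
    curveNetSaitoData_nonempty :=
  have hI : hodgePQ_independent_of_hodgeModel := hodgePQ_independent_of_hodgeModel_holds
  have hM : ∀ (m : ℕ) (Y : Motives.SchemeOver ℂ), nonempty_hodgeModel m Y := hR.nonempty_hodgeModel
  -- any orientation family will do; the closed manifolds `Y(ℂ)` are `ℂ`-orientable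
  let μ : OrientationFamily := fun _ _ hY ↦ (Motives.ComplexPoints.isOrientableOver ℂ hY).some
  curveNetSaitoData_nonempty_of_exists_isReal_hodgeModel' hR
    (fun _ _ hY A k Z hZ ↦
      kerRestriction_isSubHodge_of_gysinHodgeType hD hH hM hI μ
        (isOfHodgeType_complexGysin hI hM hdR μ) hY A k Z hZ)
    hpol

/-- **`curveNetSaitoData_nonempty` from the Hodge decomposition, Deligne's theorem, Hironaka's
resolution, the multiplicative de Rham theorem and the polarizability** — the reduction
`curveNetSaitoData_nonempty_of_namedFacts` with its first hypothesis `exists_isReal_hodgeModel`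
replaced by (4b) the Hodge decomposition of compact Kähler manifolds (`Motives.isInternal_hodgePQ`,
Voisin I Prop. 6.11) ALONE, through `exists_isReal_hodgeModel_of_hodgeDecomposition`
(`ComplexConjugationDischarge`: de Rham's theorem in real form is now the theorem
`exists_isReal_complexDeRhamIsoFamily_holds`, and smooth projective analytifications are Kähler,
`Motives.isKaehlerManifold_of_isAnalytification_of_isClosedImmersion_holds`). Hence the named fact
`curveNetSaitoData_nonempty` rests on exactly: `Motives.isInternal_hodgePQ`,
`Deligne1974_ker_restrictCompl_eq_iSup_range_complexGysin`, `Resolution.Hironaka1964_projective`,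
`exists_deRhamIsoFamily` (multiplicative form) and the un-named polarizability `hpol`.
[cite: Saito1990, Thm. 0.1–0.2, §2.g and §4.5] [cite: VoisinHodgeI2002, Prop. 6.11, Cor. 6.12, Thm. 6.32 and §7.3.2]
[cite: DeligneHodgeIII1974, Cor. 8.2.8] -/
theorem curveNetSaitoData_nonempty_of_hodgeDecomposition
    (h4b : ∀ (E : Type) [NormedAddCommGroup E] [NormedSpace ℂ E] [FiniteDimensional ℂ E]
      (M : Type) [TopologicalSpace M] [ChartedSpace E M] [IsManifold 𝓘(ℝ, E) ∞ M],
      Motives.isInternal_hodgePQ (E := E) (M := M))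
    (hD : Deligne1974_ker_restrictCompl_eq_iSup_range_complexGysin)
    (hH : Literature.AlgebraicGeometry.Resolution.Hironaka1964_projective.{0})
    (hdR : ∀ (E : Type) [NormedAddCommGroup E] [NormedSpace ℂ E] [FiniteDimensional ℂ E],
      exists_deRhamIsoFamily 𝓘(ℝ, E))
    (hpol : ∀ ⦃n : ℕ⦄ ⦃Y : Motives.SchemeOver ℂ⦄ (hY : Motives.IsSmoothProjective n Y)
      (A : HodgeModel n Y) (hA : A.IsHodgeSymmetric) (k : ℕ), (A.hodgeStructure hY hA k).IsPolarizable) :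
    curveNetSaitoData_nonempty :=
  curveNetSaitoData_nonempty_of_namedFacts (exists_isReal_hodgeModel_of_hodgeDecomposition h4b) hD hH
    hdR hpol

end HodgeTheory

end Literature.AlgebraicGeometry.HodgeTheory

end
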